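import Summits.Ventures.MM22.Rank333.ProfileCertSteps
import Mathlib.GroupTheory.OrderOfElement
import Mathlib.Logic.Relation
import Mathlib.Data.Set.Function
import HarnessLib

/-!
# MM22 venture — PROFILE-CERT kernel replay: the S-node WLOG argument

HONEST FRAMING (cell `pub-mm22`, seat p1 g5; V4-MENU item (0′) «kernel replay of the whole-root PROFILE-CERT»).
Checker PLUMBING with soundness theorems, written from the FROZEN format specification
`HOME/pub-mm22-p2/pcert/PROFILE-CERT-v1-frozen-20260822T2120Z.md` (sha256 59fc6c87…) only. The end declaration of the
chain (`ProfileCertGlue.rankGe21F2_of_pieces`) is an IMPLICATION whose antecedents are Wang's `Cert 3 3 3 [] 20`, a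
certified orbit table (Wang's printed values and the cell's 8 LP/LPDFS lifts), a passing singleton check and the
`NoExt` statement that the (not yet landed) data files assemble to. NOTHING here proves a bound on `R_𝔽₂(⟨3,3,3⟩)`;
no summit claim.

This file: `sound_orbits` (transport along reachable orbits by good maps of finite order).
-/

set_option autoImplicit false

namespace Summit.Ventures.MM22.ProfileCert

section Sym0
open Finset
variable {rt : RT} {N : ℕ} {V : Finset ℕ → Prop}
/-! ### symmetry: facts extracted from the S-node header, and the WLOG argument -/

/-- Reachability under a family of maps. -/
def Reach (σs : List (ℕ → ℕ)) : ℕ → ℕ → Prop :=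
  Relation.ReflTransGen fun a b => ∃ σ ∈ σs, σ a = b

/-- «Good» maps at a state: permute the forms, preserve IN, OUT and validity. -/
structure Good (V : Finset ℕ → Prop) (s : St) (H : ℕ → ℕ) : Prop where
  bij : Set.BijOn H (↑forms) (↑forms)
  inL : ∀ f ∈ s.inL, H f ∈ s.inL
  out : ∀ f ∈ forms, s.out.testBit f = true → s.out.testBit (H f) = true
  val : ∀ M, V M → V (M.image H)

/-- What the header check provides about the maps, at the S-node's state. -/
def SigFacts (V : Finset ℕ → Prop) (σs : List (ℕ → ℕ)) (s : St) : Prop := ∀ σ ∈ σs, Good V s σ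

/-- What the header check provides about the orbits, at the S-node's state. -/
structure OrbFacts (σs : List (ℕ → ℕ)) (s : St) (orbits : List (List ℕ)) : Prop where
  free : ∀ o ∈ orbits, ∀ f ∈ o, s.free f = true
  nodup : ∀ o ∈ orbits, o.Nodup
  disj : orbits.Pairwise (fun o o' => ∀ f ∈ o, f ∉ o')
  cover : ∀ f, s.free f = true → ∃ o ∈ orbits, f ∈ o
  closed : ∀ σ ∈ σs, ∀ o ∈ orbits, ∀ f ∈ o, σ f ∈ o
  reach : ∀ o ∈ orbits, ∀ m ∈ o, ∃ x₀, o.head? = some x₀ ∧ Reach σs x₀ m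

section Symmetry

/-- The identity is good. -/
theorem Good.id (s : St) : Good V s _root_.id :=
  ⟨Set.bijOn_id _, fun f hf => hf, fun f _ h => h, fun M hM => by simpa using hM⟩

/-- Good maps compose. -/
theorem Good.comp {s : St} {H₁ H₂ : ℕ → ℕ} (h₂ : Good V s H₂) (h₁ : Good V s H₁) : Good V s (H₂ ∘ H₁) :=
  ⟨h₂.bij.comp h₁.bij, fun f hf => h₂.inL _ (h₁.inL f hf), fun f hf ho =>
    h₂.out _ (h₁.bij.mapsTo hf) (h₁.out f hf ho), fun M hM => by
      rw [← Finset.image_image]; exact h₂.val _ (h₁.val M hM)⟩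

/-- Iterates of a good map are good. -/
theorem Good.iterate {s : St} {H : ℕ → ℕ} (h : Good V s H) : ∀ n, Good V s (H^[n])
  | 0 => Good.id s
  | n + 1 => by rw [Function.iterate_succ']; exact h.comp (Good.iterate h n)

/-- Reachability is realised by a good map. -/
theorem reach_good {σs : List (ℕ → ℕ)} {s : St} (hσ : SigFacts V σs s) {x y : ℕ} (h : Reach σs x y) :
    ∃ H, Good V s H ∧ H x = y := by
  induction h with
  | refl => exact ⟨_root_.id, Good.id s, rfl⟩
  | tail _ hbc ih =>
    obtain ⟨H, hH, rfl⟩ := ih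
    obtain ⟨σ, hσs, rfl⟩ := hbc
    exact ⟨σ ∘ H, (hσ σ hσs).comp hH, rfl⟩

/-- A bijection of the (finite) set of forms has finite order. -/
theorem exists_iterate_eq_self {H : ℕ → ℕ} (hH : Set.BijOn H (↑forms) (↑forms)) :
    ∃ k, 1 ≤ k ∧ ∀ x ∈ forms, H^[k] x = x := by
  classical
  let α := {x // x ∈ forms}
  let e : α → α := fun x => ⟨H x.1, hH.mapsTo x.2⟩
  have einj : Function.Injective e := by
    intro a b hab
    exact Subtype.ext (hH.injOn a.2 b.2 (congrArg Subtype.val hab))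
  have ebij : Function.Bijective e := Finite.injective_iff_bijective.1 einj
  let p : Equiv.Perm α := Equiv.ofBijective e ebij
  obtain ⟨k, hk, hpk⟩ := (isOfFinOrder_of_finite p).exists_pow_eq_one
  refine ⟨k, hk, fun x hx => ?_⟩
  have hiter : ∀ n (y : α), ((p ^ n) y).1 = H^[n] y.1 := by
    intro n
    induction n with
    | zero => intro y; rfl
    | succ n ih =>
      intro y
      rw [pow_succ, Equiv.Perm.mul_apply, ih, Function.iterate_succ, Function.comp_apply]
      rfl
  have := hiter k ⟨x, hx⟩
  rw [hpk] at this
  exact this.symm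

/-- **Transport**: a valid extension meeting a closed, reachable orbit can be moved to one containing the
representative. -/
theorem transport {σs : List (ℕ → ℕ)} {s : St} (hW : s.WF) (hV : VHyp0 rt N V) (hσ : SigFacts V σs s)
    {x₀ m : ℕ} (hx₀ : x₀ ∈ forms) (hreach : Reach σs x₀ m) {M : Finset ℕ} (hM : V M) (hE : s.Ext M)
    (hm : m ∈ M) : ∃ M', V M' ∧ s.Ext M' ∧ x₀ ∈ M' := by
  classical
  obtain ⟨H, hH, hHx⟩ := reach_good hσ hreach
  obtain ⟨k, hk, hHk⟩ := exists_iterate_eq_self hH.bij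
  have hG : Good V s (H^[k - 1]) := hH.iterate (k - 1)
  have hGm : H^[k - 1] m = x₀ := by
    have : H^[k] x₀ = x₀ := hHk x₀ hx₀
    rw [show k = (k - 1) + 1 by omega, Function.iterate_succ, Function.comp_apply, hHx] at this
    exact this
  refine ⟨M.image (H^[k - 1]), hG.val M hM, ⟨fun f hf => ?_, fun f hf => ?_⟩, Finset.mem_image.2 ⟨m, hm, hGm⟩⟩
  · -- IN ⊆ G(M): G permutes the IN set
    have hmaps : Set.MapsTo (H^[k - 1]) (↑s.inSet) (↑s.inSet) := fun g hg =>
      Finset.mem_coe.2 (List.mem_toFinset.2 (hG.inL g (List.mem_toFinset.1 (Finset.mem_coe.1 hg))))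
    have hinj : Set.InjOn (H^[k - 1]) (↑s.inSet) :=
      hG.bij.injOn.mono fun g hg => Finset.mem_coe.2 (hW.in_form g (List.mem_toFinset.1 (Finset.mem_coe.1 hg)))
    have hsurj : Set.SurjOn (H^[k - 1]) (↑s.inSet) (↑s.inSet) :=
      Finset.surjOn_of_injOn_of_card_le _ hmaps hinj le_rfl
    obtain ⟨g, hg, hgf⟩ := hsurj (Finset.mem_coe.2 (List.mem_toFinset.2 hf))
    exact Finset.mem_image.2 ⟨g, hE.1 g (List.mem_toFinset.1 (Finset.mem_coe.1 hg)), hgf⟩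
  · -- G(M) avoids OUT: G permutes the OUT set and M avoids it
    obtain ⟨g, hg, rfl⟩ := Finset.mem_image.1 hf
    have hgforms : g ∈ forms := hV.sub M hM hg
    cases hGo : s.out.testBit (H^[k - 1] g)
    · rfl
    · exfalso
      have hmaps : Set.MapsTo (H^[k - 1]) (↑s.outSet) (↑s.outSet) := fun g' hg' => by
        have hg'2 := Finset.mem_filter.1 (Finset.mem_coe.1 hg')
        exact Finset.mem_coe.2 (Finset.mem_filter.2 ⟨hG.bij.mapsTo hg'2.1, hG.out g' hg'2.1 hg'2.2⟩)
      have hinj : Set.InjOn (H^[k - 1]) (↑s.outSet) :=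
        hG.bij.injOn.mono fun g' hg' => Finset.mem_coe.2 (Finset.mem_filter.1 (Finset.mem_coe.1 hg')).1
      have hsurj : Set.SurjOn (H^[k - 1]) (↑s.outSet) (↑s.outSet) :=
        Finset.surjOn_of_injOn_of_card_le _ hmaps hinj le_rfl
      have hGg : H^[k - 1] g ∈ s.outSet := Finset.mem_filter.2 ⟨hG.bij.mapsTo hgforms, hGo⟩
      obtain ⟨g', hg', hgg'⟩ := hsurj (Finset.mem_coe.2 hGg)
      have hg'2 := Finset.mem_filter.1 (Finset.mem_coe.1 hg')
      have heq : g' = g := hG.bij.injOn (Finset.mem_coe.2 hg'2.1) (Finset.mem_coe.2 hgforms) hgg'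
      subst heq
      have := hE.2 g' hg
      rw [hg'2.2] at this
      exact Bool.noConfusion this

/-- `free` after `setOutL`. -/
theorem St.free_setOutL {s : St} : ∀ (l : List ℕ) (g : ℕ), (s.setOutL l).free g = true ↔ s.free g = true ∧ g ∉ l := by
  intro l
  induction l generalizing s with
  | nil => intro g; simp [St.setOutL]
  | cons f fs ih =>
    intro g
    rw [St.setOutL, ih, List.mem_cons, not_or]
    constructor
    · rintro ⟨h1, h2⟩
      obtain ⟨h3, h4⟩ := St.free_setOut h1
      exact ⟨h3, h4, h2⟩
    · rintro ⟨h1, h2, h3⟩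
      refine ⟨?_, h3⟩
      rw [St.free_spec] at h1 ⊢
      refine ⟨h1.1, h1.2.1, ?_⟩
      rw [St.testBit_setOut_out, h1.2.2, Bool.false_or, decide_eq_false_iff_not]
      exact fun e => h2 e.symm

/-- `setOutL` does not touch IN. -/
theorem St.setOutL_inL {s : St} : ∀ (l : List ℕ), (s.setOutL l).inL = s.inL := by
  intro l; induction l generalizing s with
  | nil => rfl
  | cons f fs ih => rw [St.setOutL, ih]; rfl

/-- The OUT mask after `setOutL`. -/
theorem St.testBit_setOutL_out {s : St} : ∀ (l : List ℕ) (g : ℕ),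
    (s.setOutL l).out.testBit g = true ↔ s.out.testBit g = true ∨ g ∈ l := by
  intro l; induction l generalizing s with
  | nil => intro g; simp [St.setOutL]
  | cons f fs ih =>
    intro g
    rw [St.setOutL, ih, St.testBit_setOut_out, Bool.or_eq_true, decide_eq_true_eq, List.mem_cons, or_assoc]
    constructor
    · rintro (h | h | h)
      · exact Or.inl h
      · exact Or.inr (Or.inl h.symm)
      · exact Or.inr (Or.inr h)
    · rintro (h | h | h)
      · exact Or.inl h
      · exact Or.inr (Or.inl h.symm)
      · exact Or.inr (Or.inr h)

/-- The map facts survive passing an orbit to OUT. -/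
theorem SigFacts.setOutL {σs : List (ℕ → ℕ)} {s : St} (hσ : SigFacts V σs s) {o : List ℕ}
    (hclosed : ∀ σ ∈ σs, ∀ f ∈ o, σ f ∈ o) : SigFacts V σs (s.setOutL o) := by
  intro σ hσs
  obtain ⟨hb, hi, ho, hv⟩ := hσ σ hσs
  refine ⟨hb, fun f hf => ?_, fun f hf h => ?_, hv⟩
  · rw [St.setOutL_inL] at hf ⊢; exact hi f hf
  · rw [St.testBit_setOutL_out] at h ⊢
    rcases h with h | h
    · exact Or.inl (ho f hf h)
    · exact Or.inr (hclosed σ hσs f h)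

/-- The orbit facts survive passing the first orbit to OUT. -/
theorem OrbFacts.tail {σs : List (ℕ → ℕ)} {s : St} {o : List ℕ} {os : List (List ℕ)}
    (h : OrbFacts σs s (o :: os)) : OrbFacts σs (s.setOutL o) os := by
  refine ⟨fun o' ho' f hf => ?_, fun o' ho' => h.nodup o' (List.mem_cons_of_mem o ho'), (List.pairwise_cons.1 h.disj).2,
    fun f hf => ?_, fun σ hσ o' ho' => h.closed σ hσ o' (List.mem_cons_of_mem o ho'),
    fun o' ho' => h.reach o' (List.mem_cons_of_mem o ho')⟩
  · rw [St.free_setOutL]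
    refine ⟨h.free o' (List.mem_cons_of_mem o ho') f hf, fun hfo => ?_⟩
    exact (List.pairwise_cons.1 h.disj).1 o' ho' f hfo hf
  · rw [St.free_setOutL] at hf
    obtain ⟨o', ho', hfo'⟩ := h.cover f hf.1
    rcases List.mem_cons.1 ho' with rfl | ho'
    · exact absurd hfo' hf.2
    · exact ⟨o', ho', hfo'⟩

/-- **S-node soundness** (the WLOG argument): facts about maps and orbits + the chain statement give `NoExt`. -/
theorem sound_orbits (hV : VHyp0 rt N V) {σs : List (ℕ → ℕ)} :
    ∀ (orbits : List (List ℕ)) (s : St), s.WF → SigFacts V σs s → OrbFacts σs s orbits →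
      ChainNoExt V orbits s → NoExt V s
  | [], s, _, _, _, hch => hch
  | o :: os, s, hW, hσ, ho, hch => by
    classical
    obtain ⟨hhead, hrest⟩ := hch
    intro M hM hE
    by_cases hmeet : ∃ m ∈ o, m ∈ M
    · obtain ⟨m, hmo, hmM⟩ := hmeet
      obtain ⟨x₀, hx₀, hreach⟩ := ho.reach o (by simp) m hmo
      have hx₀o : x₀ ∈ o := List.mem_of_mem_head? hx₀
      have hx₀free := ho.free o (by simp) x₀ hx₀o
      have hx₀forms : x₀ ∈ forms := (St.free_spec.1 hx₀free).1
      obtain ⟨M', hM', hE', hx₀M'⟩ := transport hW hV hσ hx₀forms hreach hM hE hmM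
      exact hhead x₀ hx₀ M' hM' (hE'.setIn_of_mem hx₀M')
    · push Not at hmeet
      have hW' : (s.setOutL o).WF := hW.setOutL o (ho.free o (by simp)) (ho.nodup o (by simp))
      exact sound_orbits hV os (s.setOutL o) hW' (hσ.setOutL (fun σ hσs f hf => ho.closed σ hσs o (by simp) f hf))
        ho.tail hrest M hM (hE.setOutL_of_disjoint o hmeet)

end Symmetry


end Sym0

end Summit.Ventures.MM22.ProfileCert
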